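import Summits.CriticalPhenomena.Ising3DConformalLimit.Theorems.PlantedPinningGaussianPinningSaturationDefs

/-!
# The torsion (Dirichlet) variational principle for the linear residual
(stub `stub_linResidualTorsion` of line `birth`, crux `GaussianPinningSaturation`,
item stmt-CriticalPhenomena-8452; objects in `…GaussianPinningSaturationDefs`)

First step of the lead's strategy for the open stub B2 `LinRiccatiSaturation` (saturation of the
linear Riccati flow = "crushed-ice" homogenisation of the precision form with random point obstacles).

**Statement** (`stub_linResidualTorsion`, registered signature verbatim). Let `Λ = Λ_L = box 3 L`,
`K = covMat L Λ` the covariance matrix `(Cov⁺_{Λ_L}(σ_a,σ_b))_{a,b∈Λ}` of ALL spins of the critical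
`+` box and `J = K⁻¹` its precision matrix. For every pin set `P ⊆ Λ` and every test vector
`f : Λ → ℝ` vanishing on `P`,
`2 Σ_a f(a) − Σ_{a,b} f(a) J(a,b) f(b) ≤ R_L(P) = linResidual L P`,
with equality for some such `f` (namely `f = χ_P`, the linear conditional susceptibility
`χ_P(z) = Σ_y (K/K_{PP})(z,y)`, `= 0` on `P`). Equivalently `R_L(P) = 1_Uᵀ (J_{UU})⁻¹ 1_U`,
`U = Λ ∖ P`: the linear residual is the torsional rigidity of the randomly perforated domain `U`
for the (nonlocal) discrete form `⟨f, J f⟩`.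

**Proof** (finite sums; abstract part for centred observables `t_x`, positive weights `w`,
Gram matrix `G(x,y) = Σ w t_x t_y`): `K` is nonsingular (one-site-flip argument,
`isUnit_det_gram`); the least-squares residual `R* = M − β*·t_P` satisfies the normal equations and
`Σ w R*² = R_L(P)` (`residual`). For a test vector `f` vanishing on `P` put `g = J f`, so `K g = f`,
and let `G_f = Σ_a g(a) t_a`; then `Σ w G_f² = Σ_a f(a) g(a) = ⟨f, J f⟩` and
`Σ w R* G_f = Σ_a f(a)` (the pins drop out because `f|_P = 0`), whence
`0 ≤ Σ w (R* − G_f)² = R_L(P) − 2Σ f + ⟨f,Jf⟩`. Equality: `G_f = R*`, i.e. `f = K g*` with `g*` the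
coefficient vector of `R*`, which vanishes on `P` by the normal equations. Folklore (Legendre duality
for a positive-definite quadratic form / block-inverse formula `(K⁻¹)_{UU} = (K/K_{PP})⁻¹`).

References: Horn–Johnson, *Matrix Analysis* (2013), §0.7.3 and §7.7 (Schur complements, block
inverses); least squares / normal equations (folklore); for the role of the torsion problem in
pinning: M. Kac, Rocky Mountain J. Math. 4 (1974) 511; J. Rauch, M. Taylor, J. Funct. Anal. 18
(1975) 27; L. Caffarelli, A. Mellet, arXiv:0711.2266 (random homogenisation of fractional obstacle
problems).
-/

noncomputable section

namespace Summit.CriticalPhenomena.Ising3DConformalLimit.PlantedPinningGaussianPinningSaturation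

open scoped BigOperators Classical
open Finset MeasureTheory Matrix
open Literature.Probability.LatticeModels
open Summit.CriticalPhenomena.Ising3DConformalLimit.Theses.PlantedPinning

/-! ### Least squares and Legendre duality for a finite weighted family of centred observables -/

section Abstract

variable {V Ω : Type*} [DecidableEq V] [Fintype Ω]

/-- Pure algebra: a weighted moment against a linear combination of observables is the
corresponding combination of moments. [folklore] -/
private theorem wsum_mul_lin {ι : Type*} (w g : Ω → ℝ) (Q : Finset ι) (γ : ι → ℝ)
    (u : ι → Ω → ℝ) :
    ∑ ω, w ω * g ω * (∑ x ∈ Q, γ x * u x ω) = ∑ x ∈ Q, γ x * ∑ ω, w ω * g ω * u x ω := by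
  simp only [Finset.mul_sum]
  rw [Finset.sum_comm]
  exact Finset.sum_congr rfl fun x _ => Finset.sum_congr rfl fun ω _ => by ring

/-- Pure algebra: a weighted moment against a sum of observables. [folklore] -/
private theorem wsum_mul_sum {ι : Type*} (w g : Ω → ℝ) (Q : Finset ι) (u : ι → Ω → ℝ) :
    ∑ ω, w ω * g ω * (∑ x ∈ Q, u x ω) = ∑ x ∈ Q, ∑ ω, w ω * g ω * u x ω := by
  simp only [Finset.mul_sum]
  exact Finset.sum_comm

variable {w : Ω → ℝ} {t : V → Ω → ℝ} {G : V → V → ℝ} {Λ : Finset V} {c : V → ℝ}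
  {Mc : Ω → ℝ} {Rs : Finset V → ℝ}
  (hw : ∀ ω, 0 < w ω) (hG : ∀ x y, G x y = ∑ ω, w ω * t x ω * t y ω)
  (hflip : ∀ x ∈ Λ, ∃ ω ω', t x ω ≠ t x ω' ∧ ∀ y, y ≠ x → t y ω = t y ω')
  (hc : ∀ y, c y = ∑ x ∈ Λ, G x y) (hMc : ∀ ω, Mc ω = ∑ x ∈ Λ, t x ω)
  (hRs : ∀ P : Finset V, Rs P = (∑ x ∈ Λ, ∑ y ∈ Λ, G x y) -
      ∑ a : ↥P, ∑ b : ↥P, c a * (Matrix.of fun a b : ↥P => G a b)⁻¹ a b * c b)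

include hw hG hflip in
/-- The Gram matrix `(G(a,b))_{a,b ∈ P}` is nonsingular for `P ⊆ Λ`: its quadratic form is
`Σ w (Σ_a v_a t_a)²`, which vanishes only if `Σ_a v_a t_a ≡ 0` (all `w > 0`), and a single-site
modification of a pattern rules this out unless `v = 0`. [folklore] -/
private theorem isUnit_det_gram {P : Finset V} (hP : P ⊆ Λ) :
    IsUnit (Matrix.of fun a b : ↥P => G a b).det := by
  set GP : Matrix ↥P ↥P ℝ := Matrix.of fun a b : ↥P => G a b with hGP
  rw [← Matrix.isUnit_iff_isUnit_det, ← Matrix.mulVec_injective_iff_isUnit]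
  intro v v' hvv'
  rw [← sub_eq_zero]
  set u : ↥P → ℝ := v - v' with hu
  have hu0 : GP *ᵥ u = 0 := by rw [hu, Matrix.mulVec_sub, hvv', sub_self]
  set f : Ω → ℝ := fun ω => ∑ a : ↥P, u a * t a ω with hf
  have hrow : ∀ b : ↥P, ∑ ω, w ω * f ω * t b ω = (GP *ᵥ u) b := fun b => by
    calc ∑ ω, w ω * f ω * t b ω = ∑ ω, w ω * t b ω * ∑ a : ↥P, u a * t a ω :=
          Finset.sum_congr rfl fun ω _ => by simp only [hf]; ring
      _ = ∑ a : ↥P, u a * ∑ ω, w ω * t b ω * t a ω :=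
          wsum_mul_lin w (t b) Finset.univ u fun a : ↥P => t a
      _ = (GP *ᵥ u) b := by
          rw [Matrix.mulVec_apply_eq_sum]
          exact Finset.sum_congr rfl fun a _ => by rw [hGP, Matrix.of_apply, hG]; ring
  have hz : ∑ ω, w ω * f ω ^ 2 = 0 := by
    calc ∑ ω, w ω * f ω ^ 2 = ∑ ω, w ω * f ω * ∑ b : ↥P, u b * t b ω :=
          Finset.sum_congr rfl fun ω _ => by simp only [hf]; ring
      _ = ∑ b : ↥P, u b * ∑ ω, w ω * f ω * t b ω :=
          wsum_mul_lin w f Finset.univ u fun b : ↥P => t b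
      _ = 0 := by simp [hrow, hu0]
  have hf0 : ∀ ω, f ω = 0 := fun ω => by
    have h := (Finset.sum_eq_zero_iff_of_nonneg fun ω _ =>
      mul_nonneg (hw ω).le (sq_nonneg (f ω))).1 hz ω (Finset.mem_univ ω)
    exact (pow_eq_zero_iff two_ne_zero).1 ((mul_eq_zero.1 h).resolve_left (hw ω).ne')
  refine funext fun a => Classical.byContradiction fun hua => ?_
  obtain ⟨ω, ω', hx, hy⟩ := hflip a (hP a.2)
  have hdiff : f ω - f ω' = u a * (t a ω - t a ω') := by
    simp only [hf]
    rw [← Finset.sum_sub_distrib, Finset.sum_eq_single a]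
    · ring
    · exact fun b _ hb => by rw [hy b (fun h => hb (Subtype.ext h)), sub_self]
    · exact fun h => absurd (Finset.mem_univ a) h
  rw [hf0 ω, hf0 ω', sub_self] at hdiff
  exact mul_ne_zero hua (sub_ne_zero.2 hx) hdiff.symm

include hw hG hflip hc hMc hRs in
/-- **Least squares** for `M = Σ_{x ∈ Λ} t_x` on the observables `t_P`, `P ⊆ Λ`: the residual
`R = M − β*·t_P` with `β* = G_{PP}⁻¹ c_P` satisfies the normal equations `Σ w R t_y = 0`
(`y ∈ P`) and `Σ w R M = Σ w R² = Rs P = Var M − cᵀ G_{PP}⁻¹ c`. [folklore] -/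
private theorem residual {P : Finset V} (hP : P ⊆ Λ) :
    ∃ (β : V → ℝ) (R : Ω → ℝ), (∀ ω, R ω = Mc ω - ∑ x ∈ P, β x * t x ω) ∧
      (∀ y ∈ P, ∑ ω, w ω * R ω * t y ω = 0) ∧
      ∑ ω, w ω * R ω * Mc ω = Rs P ∧ ∑ ω, w ω * R ω ^ 2 = Rs P := by
  set β' : ↥P → ℝ := (Matrix.of fun a b : ↥P => G a b)⁻¹ *ᵥ fun a => c a with hβ'
  -- normal equations in matrix form: `G_{PP} β* = c_P`
  have hne : ∀ y (hy : y ∈ P), ∑ a : ↥P, G y a * β' a = c y := fun y hy => by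
    have h : ((Matrix.of fun a b : ↥P => G a b) *ᵥ β') ⟨y, hy⟩ = c y := by
      rw [hβ', Matrix.mulVec_mulVec, Matrix.mul_nonsing_inv _ (isUnit_det_gram hw hG hflip hP),
        Matrix.one_mulVec]
    simpa only [Matrix.mulVec_apply_eq_sum, Matrix.of_apply] using h
  set βV : V → ℝ := fun x => if hx : x ∈ P then β' ⟨x, hx⟩ else 0 with hβV
  set R : Ω → ℝ := fun ω => Mc ω - ∑ x ∈ P, βV x * t x ω with hR
  -- moments of `M`, of `β*·t_P` and of `R` against an observable
  have hMt : ∀ y, ∑ ω, w ω * Mc ω * t y ω = c y := fun y => by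
    calc ∑ ω, w ω * Mc ω * t y ω = ∑ ω, w ω * t y ω * ∑ x ∈ Λ, t x ω :=
          Finset.sum_congr rfl fun ω _ => by rw [hMc]; ring
      _ = c y := by
          rw [wsum_mul_sum, hc]
          refine Finset.sum_congr rfl fun x _ => ?_
          rw [hG]; exact Finset.sum_congr rfl fun ω _ => by ring
  have hℓg : ∀ g : Ω → ℝ, ∑ ω, w ω * g ω * (∑ x ∈ P, βV x * t x ω) =
      ∑ a : ↥P, β' a * ∑ ω, w ω * g ω * t a ω := fun g => by
    have hℓ : ∀ ω, ∑ x ∈ P, βV x * t x ω = ∑ a : ↥P, β' a * t a ω := fun ω => by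
      rw [← Finset.sum_coe_sort P (fun x => βV x * t x ω)]
      exact Finset.sum_congr rfl fun a _ => by simp [hβV]
    simp only [hℓ]
    exact wsum_mul_lin w g Finset.univ β' fun a : ↥P => t a
  have hsplit : ∀ g : Ω → ℝ, ∑ ω, w ω * R ω * g ω =
      ∑ ω, w ω * Mc ω * g ω - ∑ ω, w ω * g ω * (∑ x ∈ P, βV x * t x ω) := fun g => by
    rw [← Finset.sum_sub_distrib]; exact Finset.sum_congr rfl fun ω _ => by rw [hR]; ring
  have h0 : ∀ y ∈ P, ∑ ω, w ω * R ω * t y ω = 0 := fun y hy => by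
    rw [hsplit, hMt, hℓg, ← hne y hy, ← Finset.sum_sub_distrib]
    exact Finset.sum_eq_zero fun a _ => by rw [← hG]; ring
  have hMM : ∑ ω, w ω * Mc ω * Mc ω = ∑ x ∈ Λ, ∑ y ∈ Λ, G x y := by
    calc ∑ ω, w ω * Mc ω * Mc ω = ∑ ω, w ω * Mc ω * ∑ y ∈ Λ, t y ω :=
          Finset.sum_congr rfl fun ω _ => by rw [← hMc]
      _ = ∑ y ∈ Λ, c y := by rw [wsum_mul_sum]; exact Finset.sum_congr rfl fun y _ => hMt y
      _ = ∑ x ∈ Λ, ∑ y ∈ Λ, G x y := by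
          rw [Finset.sum_comm]; exact Finset.sum_congr rfl fun y _ => hc y
  have hM : ∑ ω, w ω * R ω * Mc ω = Rs P := by
    rw [hsplit, hℓg, hMM, hRs P]
    congr 1
    refine Finset.sum_congr rfl fun a _ => ?_
    rw [hMt, hβ', Matrix.mulVec_apply_eq_sum, Finset.sum_mul]
    exact Finset.sum_congr rfl fun b _ => by ring
  have hRR : ∑ ω, w ω * R ω ^ 2 = Rs P := by
    calc ∑ ω, w ω * R ω ^ 2
          = ∑ ω, w ω * R ω * Mc ω - ∑ ω, w ω * R ω * ∑ x ∈ P, βV x * t x ω := by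
          rw [← Finset.sum_sub_distrib]; exact Finset.sum_congr rfl fun ω _ => by rw [hR]; ring
      _ = Rs P := by
          rw [hM, wsum_mul_lin w R P βV t, Finset.sum_eq_zero fun x hx => ?_, sub_zero]
          rw [h0 x hx, mul_zero]
  exact ⟨βV, R, fun ω => rfl, h0, hM, hRR⟩

include hw hG hflip hc hMc hRs in
/-- **Legendre duality (torsion principle)** for the linear residual: with `K = (G(a,b))_{a,b∈Λ}`
and the precision matrix `J = K⁻¹`, for every `f : Λ → ℝ` vanishing on `P`,
`2 Σ_a f(a) − Σ_{a,b} f(a) J(a,b) f(b) ≤ Rs P`, with equality for `f = K g*`, `g*` the coefficient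
vector of the least-squares residual `R*` (which vanishes on `P` by the normal equations).
[folklore] -/
private theorem torsion {P : Finset V} (hP : P ⊆ Λ) :
    (∀ f : ↥Λ → ℝ, (∀ a : ↥Λ, (a : V) ∈ P → f a = 0) →
        2 * ∑ a, f a - ∑ a, ∑ b, f a * (Matrix.of fun a b : ↥Λ => G a b)⁻¹ a b * f b ≤ Rs P) ∧
    (∃ f : ↥Λ → ℝ, (∀ a : ↥Λ, (a : V) ∈ P → f a = 0) ∧
        2 * ∑ a, f a - ∑ a, ∑ b, f a * (Matrix.of fun a b : ↥Λ => G a b)⁻¹ a b * f b = Rs P) := by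
  set K : Matrix ↥Λ ↥Λ ℝ := Matrix.of fun a b : ↥Λ => G a b with hK
  have hKu : IsUnit K.det := isUnit_det_gram hw hG hflip (subset_refl Λ)
  obtain ⟨β, R, hRdef, h0, _hM, hRR⟩ := residual hw hG hflip hc hMc hRs hP
  -- linear statistics `lin g = Σ_a g(a) t_a` and their moments
  have hlinT : ∀ (g : ↥Λ → ℝ) (b : ↥Λ),
      ∑ ω, w ω * (∑ a, g a * t a ω) * t b ω = (K *ᵥ g) b := fun g b => by
    calc ∑ ω, w ω * (∑ a, g a * t a ω) * t b ω = ∑ ω, w ω * t b ω * ∑ a, g a * t a ω :=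
          Finset.sum_congr rfl fun ω _ => by ring
      _ = ∑ a, g a * ∑ ω, w ω * t b ω * t a ω := wsum_mul_lin w (t b) Finset.univ g fun a => t a
      _ = (K *ᵥ g) b := by
          rw [Matrix.mulVec_apply_eq_sum]
          exact Finset.sum_congr rfl fun a _ => by rw [hK, Matrix.of_apply, hG]; ring
  have hlin2 : ∀ g : ↥Λ → ℝ,
      ∑ ω, w ω * (∑ a, g a * t a ω) ^ 2 = ∑ b, g b * (K *ᵥ g) b := fun g => by
    calc ∑ ω, w ω * (∑ a, g a * t a ω) ^ 2
          = ∑ ω, w ω * (∑ a, g a * t a ω) * ∑ b, g b * t b ω :=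
          Finset.sum_congr rfl fun ω _ => by ring
      _ = ∑ b, g b * ∑ ω, w ω * (∑ a, g a * t a ω) * t b ω :=
          wsum_mul_lin w _ Finset.univ g fun b => t b
      _ = ∑ b, g b * (K *ᵥ g) b := Finset.sum_congr rfl fun b _ => by rw [hlinT]
  -- `Σ w R (lin g) = Σ_b (K g)(b) − Σ_{x∈P} β_x (K g)(x)`
  have hRlin : ∀ g : ↥Λ → ℝ, (∀ a : ↥Λ, (a : V) ∈ P → (K *ᵥ g) a = 0) →
      ∑ ω, w ω * R ω * (∑ a, g a * t a ω) = ∑ b, (K *ᵥ g) b := by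
    intro g hg0
    have h1 : ∑ ω, w ω * Mc ω * (∑ a, g a * t a ω) = ∑ b, (K *ᵥ g) b := by
      calc ∑ ω, w ω * Mc ω * (∑ a, g a * t a ω)
            = ∑ ω, w ω * (∑ a, g a * t a ω) * ∑ x ∈ Λ, t x ω :=
            Finset.sum_congr rfl fun ω _ => by rw [hMc]; ring
        _ = ∑ x ∈ Λ, ∑ ω, w ω * (∑ a, g a * t a ω) * t x ω := wsum_mul_sum w _ Λ t
        _ = ∑ b, (K *ᵥ g) b := by
            rw [← Finset.sum_coe_sort Λ]
            exact Finset.sum_congr rfl fun b _ => hlinT g b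
    have h2 : ∑ ω, w ω * (∑ x ∈ P, β x * t x ω) * (∑ a, g a * t a ω) = 0 := by
      calc ∑ ω, w ω * (∑ x ∈ P, β x * t x ω) * (∑ a, g a * t a ω)
            = ∑ ω, w ω * (∑ a, g a * t a ω) * (∑ x ∈ P, β x * t x ω) :=
            Finset.sum_congr rfl fun ω _ => by ring
        _ = ∑ x ∈ P, β x * ∑ ω, w ω * (∑ a, g a * t a ω) * t x ω := wsum_mul_lin w _ P β t
        _ = 0 := Finset.sum_eq_zero fun x hx => by
            rw [hlinT g ⟨x, hP hx⟩, hg0 ⟨x, hP hx⟩ hx, mul_zero]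
    calc ∑ ω, w ω * R ω * (∑ a, g a * t a ω)
          = ∑ ω, w ω * Mc ω * (∑ a, g a * t a ω)
            - ∑ ω, w ω * (∑ x ∈ P, β x * t x ω) * (∑ a, g a * t a ω) := by
          rw [← Finset.sum_sub_distrib]
          exact Finset.sum_congr rfl fun ω _ => by rw [hRdef]; ring
      _ = ∑ b, (K *ᵥ g) b := by rw [h1, h2, sub_zero]
  refine ⟨fun f hf => ?_, ?_⟩
  · -- upper bound: `g = K⁻¹ f`, `0 ≤ Σ w (R − lin g)²`
    set g : ↥Λ → ℝ := K⁻¹ *ᵥ f with hg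
    have hKg : K *ᵥ g = f := by
      rw [hg, Matrix.mulVec_mulVec, Matrix.mul_nonsing_inv _ hKu, Matrix.one_mulVec]
    have hquad : ∑ a, ∑ b, f a * K⁻¹ a b * f b = ∑ a, f a * g a := by
      refine Finset.sum_congr rfl fun a _ => ?_
      rw [hg, Matrix.mulVec_apply_eq_sum, Finset.mul_sum]
      exact Finset.sum_congr rfl fun b _ => by ring
    have hcross : ∑ ω, w ω * R ω * (∑ a, g a * t a ω) = ∑ b, f b := by
      rw [hRlin g (fun a ha => by rw [hKg]; exact hf a ha), hKg]
    have hsq : ∑ ω, w ω * (∑ a, g a * t a ω) ^ 2 = ∑ a, f a * g a := by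
      rw [hlin2, hKg]
      exact Finset.sum_congr rfl fun b _ => by ring
    have hpos : 0 ≤ ∑ ω, w ω * (R ω - ∑ a, g a * t a ω) ^ 2 :=
      Finset.sum_nonneg fun ω _ => mul_nonneg (hw ω).le (sq_nonneg _)
    have hexp : ∑ ω, w ω * (R ω - ∑ a, g a * t a ω) ^ 2 = ∑ ω, w ω * R ω ^ 2
        - 2 * ∑ ω, w ω * R ω * (∑ a, g a * t a ω) + ∑ ω, w ω * (∑ a, g a * t a ω) ^ 2 := by
      rw [Finset.mul_sum, ← Finset.sum_sub_distrib, ← Finset.sum_add_distrib]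
      exact Finset.sum_congr rfl fun ω _ => by ring
    rw [hRR, hcross, hsq] at hexp
    rw [hquad]
    linarith
  · -- equality: `g* =` coefficient vector of `R`, `f = K g*`
    set g : ↥Λ → ℝ := fun a => 1 - (if (a : V) ∈ P then β a else 0) with hg
    have hlinR : ∀ ω, ∑ a, g a * t a ω = R ω := fun ω => by
      have h1 : ∑ a : ↥Λ, g a * t a ω = ∑ x ∈ Λ, (1 - (if x ∈ P then β x else 0)) * t x ω :=
        Finset.sum_coe_sort Λ (fun x => (1 - (if x ∈ P then β x else 0)) * t x ω)
      have h2 : ∑ x ∈ Λ, (1 - (if x ∈ P then β x else 0)) * t x ω =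
          ∑ x ∈ Λ, t x ω - ∑ x ∈ Λ, (if x ∈ P then β x else 0) * t x ω := by
        rw [← Finset.sum_sub_distrib]; exact Finset.sum_congr rfl fun x _ => by ring
      have h3 : ∑ x ∈ Λ, (if x ∈ P then β x else 0) * t x ω = ∑ x ∈ P, β x * t x ω := by
        rw [← Finset.sum_subset hP (f := fun x => (if x ∈ P then β x else 0) * t x ω)
          (fun x _ hx => by rw [if_neg hx, zero_mul])]
        exact Finset.sum_congr rfl fun x hx => by rw [if_pos hx]
      rw [h1, h2, h3, hRdef, hMc]
    set f : ↥Λ → ℝ := K *ᵥ g with hf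
    have hf0 : ∀ a : ↥Λ, (a : V) ∈ P → f a = 0 := fun a ha => by
      rw [hf, ← hlinT g a]
      calc ∑ ω, w ω * (∑ a, g a * t a ω) * t a ω = ∑ ω, w ω * R ω * t a ω :=
            Finset.sum_congr rfl fun ω _ => by rw [hlinR]
        _ = 0 := h0 a ha
    refine ⟨f, hf0, ?_⟩
    have hJf : K⁻¹ *ᵥ f = g := by
      rw [hf, Matrix.mulVec_mulVec, Matrix.nonsing_inv_mul _ hKu, Matrix.one_mulVec]
    have hquad : ∑ a, ∑ b, f a * K⁻¹ a b * f b = ∑ a, f a * g a := by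
      refine Finset.sum_congr rfl fun a _ => ?_
      rw [← hJf, Matrix.mulVec_apply_eq_sum, Finset.mul_sum]
      exact Finset.sum_congr rfl fun b _ => by ring
    have hcross : ∑ b, f b = Rs P := by
      rw [hf, ← hRlin g (fun a ha => hf0 a ha), ← hRR]
      exact Finset.sum_congr rfl fun ω _ => by rw [hlinR]; ring
    have hsq : ∑ a, f a * g a = Rs P := by
      have := hlin2 g
      rw [← hRR]
      calc ∑ a, f a * g a = ∑ b, g b * (K *ᵥ g) b := Finset.sum_congr rfl fun a _ => by rw [hf]; ring
        _ = ∑ ω, w ω * (∑ a, g a * t a ω) ^ 2 := this.symm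
        _ = ∑ ω, w ω * R ω ^ 2 := Finset.sum_congr rfl fun ω _ => by rw [hlinR]
    rw [hquad, hcross, hsq]
    ring

end Abstract

/-! ### The Ising instantiation -/

/-- **Stub `stub_linResidualTorsion`** (registered signature, verbatim): the torsion (Dirichlet)
variational principle `R_L(P) = max {2Σf − ⟨f, (cov_L)⁻¹ f⟩ : f|_P = 0}` for the linear residual
of the critical `+` box (`torsion` with `t_x = σ_x − ⟨σ_x⟩⁺_L`, `w = w⁺_L/Z`, `G = cov L`).
[folklore] -/
theorem stub_linResidualTorsion :
    ∀ (L : ℕ) (P : Finset (Site 3)), P ⊆ box 3 L →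
      (∀ f : ↥(box 3 L) → ℝ, (∀ a : ↥(box 3 L), (a : Site 3) ∈ P → f a = 0) →
          2 * ∑ a, f a - ∑ a, ∑ b, f a * (covMat L (box 3 L))⁻¹ a b * f b ≤ linResidual L P) ∧
      (∃ f : ↥(box 3 L) → ℝ, (∀ a : ↥(box 3 L), (a : Site 3) ∈ P → f a = 0) ∧
          2 * ∑ a, f a - ∑ a, ∑ b, f a * (covMat L (box 3 L))⁻¹ a b * f b = linResidual L P) := by
  intro L P hP
  -- the plus state as a finite probability vector with positive entries
  have hZpos : 0 < isingPartitionFunction (zdGraph 3) (box 3 L) (criticalBeta 3) 0 .plus :=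
    isingPartitionFunction_pos _ _ _ _ _
  have hwpos : ∀ τ, 0 < plusProb L τ := fun τ =>
    div_pos (isingWeight_pos (zdGraph 3) (box 3 L) (criticalBeta 3) 0 .plus τ) hZpos
  have hw1 : ∑ τ, plusProb L τ = 1 := by
    unfold plusProb; rw [← Finset.sum_div, div_eq_one_iff_eq hZpos.ne']; rfl
  have hplusE : ∀ {f : SpinConfig (Site 3) → ℝ}, Measurable f →
      plusE L f = ∑ τ, plusProb L τ * f (glue (box 3 L) τ .plus) := by
    intro f hf
    have h : plusE L f = (∑ τ, isingWeight (zdGraph 3) (box 3 L) (criticalBeta 3) 0 .plus τ *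
        f (glue (box 3 L) τ .plus)) /
          isingPartitionFunction (zdGraph 3) (box 3 L) (criticalBeta 3) 0 .plus :=
      integral_isingMeasure (zdGraph 3) (box 3 L) (criticalBeta 3) 0 .plus hf
    rw [h, Finset.sum_div]
    exact Finset.sum_congr rfl fun τ _ => by unfold plusProb; ring
  -- centred spins `t_x = σ_x − ⟨σ_x⟩⁺`
  set s : Site 3 → (↥(box 3 L) → ℤˣ) → ℝ := fun x τ => spinAt x (glue (box 3 L) τ .plus) with hs
  set t : Site 3 → (↥(box 3 L) → ℤˣ) → ℝ := fun x τ => s x τ - plusE L (spinAt x) with ht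
  have hμ : ∀ x, ∑ τ, plusProb L τ * s x τ = plusE L (spinAt x) := fun x =>
    (hplusE (measurable_spinAt x)).symm
  have hG : ∀ x y, cov L x y = ∑ τ, plusProb L τ * t x τ * t y τ := by
    intro x y
    have h1 : plusE L (fun σ => spinAt x σ * spinAt y σ) = ∑ τ, plusProb L τ * (s x τ * s y τ) :=
      hplusE ((measurable_spinAt x).fun_mul (measurable_spinAt y))
    have h2 : ∀ τ, plusProb L τ * t x τ * t y τ = plusProb L τ * (s x τ * s y τ)
        - plusE L (spinAt y) * (plusProb L τ * s x τ) - plusE L (spinAt x) * (plusProb L τ * s y τ)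
        + plusE L (spinAt x) * plusE L (spinAt y) * plusProb L τ := fun τ => by
      simp only [ht]; ring
    unfold cov
    rw [h1, Finset.sum_congr rfl fun τ _ => h2 τ, Finset.sum_add_distrib, Finset.sum_sub_distrib,
      Finset.sum_sub_distrib, ← Finset.mul_sum, ← Finset.mul_sum, ← Finset.mul_sum, hμ, hμ, hw1]
    ring
  -- flipping one spin of the all-plus pattern changes exactly one centred spin
  have hflip : ∀ x ∈ box 3 L, ∃ ω ω' : ↥(box 3 L) → ℤˣ,
      t x ω ≠ t x ω' ∧ ∀ y, y ≠ x → t y ω = t y ω' := by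
    intro x hx
    refine ⟨fun _ => 1, Function.update (fun _ => 1) ⟨x, hx⟩ (-1), ?_, fun y hy => ?_⟩
    · simp only [ht, hs, spinAt, glue_apply_of_mem _ _ _ hx, Function.update_self]
      norm_num
    · by_cases hyΛ : y ∈ box 3 L
      · have hne : (⟨y, hyΛ⟩ : ↥(box 3 L)) ≠ ⟨x, hx⟩ := fun h => hy (congrArg Subtype.val h)
        simp only [ht, hs, spinAt, glue_apply_of_mem _ _ _ hyΛ, Function.update_of_ne hne]
      · simp only [ht, hs, spinAt, glue_apply_of_notMem _ _ _ hyΛ]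
  -- the abstract torsion principle
  exact torsion (w := plusProb L) (t := t) (G := cov L) (Λ := box 3 L)
    (c := covTot L) (Mc := fun τ => ∑ x ∈ box 3 L, t x τ) (Rs := linResidual L)
    hwpos hG hflip (fun _ => rfl) (fun _ => rfl) (fun _ => rfl) hP

end Summit.CriticalPhenomena.Ising3DConformalLimit.PlantedPinningGaussianPinningSaturation

end
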